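import Mathlib
import Summits.ValiantsHypothesis.ValiantsHypothesis.Theses.BarrierLever

/-!
# Route BarrierLever — conjecture TT (`TransversalMinorLayoutsNonsingular`, stmt-ValiantsHypothesis-19152):
# compound-minor pairings, part 1 — symmetry, the permutation base case, the layout dictionary

**Setting (cell valiant-natproofs, rung V4, 𝒟-side; seat val-np-p2 gen 2).** For a matrix
`g : ι × ι → ℂ` and two families of `α`-indexed tuples of symbols `F F' : κ → α → ι` put
`P_g[j, i] := det (g.submatrix (F j) (F' i))` (the minor of `g` with rows `F j`, columns `F' i`)
and call the pair `(F, F')` *good* when `det P_g ≠ 0` for some `g`.  Item 19152 (TT) says that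
every pair of injective transversal layouts `(ρ ∘ u, τ ∘ w)` is good
(`transversalMinor_layout_good_iff`, a definitional unfolding; the transversal tuples are injective by
the tree's `ResultantKernel.rowT_injective` / `colT_injective`).

* `pairing_good_comm`: goodness is symmetric in the two families (`g ↦ gᵀ`).
* `pairing_good_of_iso` (BASE CASE of the compression criterion, see the companion file
  `BarrierLeverTransversalMinorLayoutsCompression`): if `F'` is `F` up to a symbol permutation,
  a re-indexing of the members and a reordering inside each member (members of `F` injective with
  pairwise distinct ranges), then `(F, F')` is good — for `g` a permutation matrix the pairing
  matrix is a signed permutation matrix.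

Definition-free, Mathlib only.  WHAT THIS IS NOT: no statement about TT itself beyond the
dictionary; nothing on crux 14610 or VP versus VNP.
-/

-- layout Summits/ValiantsHypothesis/ValiantsHypothesis forces the duplicated namespace component
set_option linter.dupNamespace false

open Matrix Finset

namespace Summit.ValiantsHypothesis.ValiantsHypothesis.Theorems.BarrierLever.Compression

variable {κ α ι : Type*} [Fintype κ] [DecidableEq κ] [Fintype α] [DecidableEq α]
  [Fintype ι] [DecidableEq ι]

/-! ## 1. Symmetry of the pairing -/

omit [Fintype κ] [DecidableEq κ] [Fintype ι] [DecidableEq ι] in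
/-- Transposing `g` swaps the roles of the two families (entrywise). -/
theorem pairing_transpose (g : Matrix ι ι ℂ) (F F' : κ → α → ι) :
    (Matrix.of fun j i => (g.submatrix (F j) (F' i)).det) =
      (Matrix.of fun i j => (gᵀ.submatrix (F' i) (F j)).det)ᵀ := by
  ext j i
  simp only [of_apply, transpose_apply]
  rw [show gᵀ.submatrix (F' i) (F j) = (g.submatrix (F j) (F' i))ᵀ from by
    ext a b; simp [submatrix_apply, transpose_apply]]
  rw [det_transpose]

omit [Fintype ι] [DecidableEq ι] in
/-- Goodness of a pair of families is symmetric. -/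
theorem pairing_good_comm (F F' : κ → α → ι) :
    (∃ g : Matrix ι ι ℂ, (Matrix.of fun j i => (g.submatrix (F j) (F' i)).det).det ≠ 0) ↔
      (∃ g : Matrix ι ι ℂ, (Matrix.of fun i j => (g.submatrix (F' i) (F j)).det).det ≠ 0) := by
  constructor
  · rintro ⟨g, hg⟩
    refine ⟨gᵀ, ?_⟩
    rw [pairing_transpose] at hg
    rwa [det_transpose] at hg
  · rintro ⟨g, hg⟩
    refine ⟨gᵀ, ?_⟩
    rw [pairing_transpose, det_transpose]
    simpa only [transpose_transpose] using hg

/-! ## 2. Base case: isomorphic families are good (permutation matrices) -/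

omit [Fintype α] [Fintype ι] in
/-- A `0/1` coincidence matrix between an injective tuple and a reordering of itself is a
permutation matrix. -/
theorem coincidence_self (f : α → ι) (hf : Function.Injective f) (τ : Equiv.Perm α) :
    (Matrix.of fun a b : α => if f a = f (τ b) then (1 : ℂ) else 0) =
      Equiv.Perm.permMatrix ℂ (Equiv.symm τ) := by
  ext a b
  simp only [of_apply, Equiv.Perm.permMatrix, PEquiv.toMatrix_apply, Equiv.toPEquiv_apply,
    Option.mem_def, Option.some.injEq]
  by_cases h : a = τ b
  · subst h
    simp
  · have h1 : f a ≠ f (τ b) := fun e => h (hf e)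
    have h2 : ¬ (Equiv.symm τ) a = b := by
      intro e; apply h; rw [← e]; simp
    rw [if_neg h1, if_neg h2]

omit [Fintype ι] in
/-- A coincidence matrix between injective tuples with different ranges has a zero column. -/
theorem det_coincidence_of_range_ne (f f₀ : α → ι) (hf₀ : Function.Injective f₀)
    (hne : Finset.univ.image f ≠ Finset.univ.image f₀) (τ : Equiv.Perm α) :
    (Matrix.of fun a b : α => if f a = f₀ (τ b) then (1 : ℂ) else 0).det = 0 := by
  classical
  have hcard : (Finset.univ.image f₀).card = Fintype.card α := by
    rw [Finset.card_image_of_injective _ hf₀, Finset.card_univ]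
  have hnot : ¬ Finset.univ.image f₀ ⊆ Finset.univ.image f := by
    intro hsub
    apply hne
    refine (Finset.eq_of_subset_of_card_le hsub ?_).symm
    rw [hcard]
    exact Finset.card_image_le.trans (by simp)
  obtain ⟨x, hx, hxnot⟩ := Finset.not_subset.mp hnot
  obtain ⟨a₀, _, rfl⟩ := Finset.mem_image.mp hx
  refine det_eq_zero_of_column_eq_zero ((Equiv.symm τ) a₀) fun a => ?_
  simp only [of_apply, Equiv.apply_symm_apply]
  rw [if_neg]
  intro e
  apply hxnot
  exact Finset.mem_image.mpr ⟨a, Finset.mem_univ _, e⟩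

omit [Fintype ι] in
/-- BASE CASE.  If `F'` is `F` up to a symbol permutation `π`, a re-indexing `σ` of the members
and reorderings `τ i` inside the members, and the members of `F` are injective tuples with pairwise
distinct ranges, then the pair `(F, F')` is good: for `g` the permutation matrix of `π` the pairing
matrix is a signed permutation matrix. -/
theorem pairing_good_of_iso (F F' : κ → α → ι) (hF : ∀ j, Function.Injective (F j))
    (hdist : ∀ j j', Finset.univ.image (F j) = Finset.univ.image (F j') → j = j')
    (π : Equiv.Perm ι) (σ : Equiv.Perm κ) (τ : κ → Equiv.Perm α)
    (hF' : ∀ i a, F' i a = π (F (σ i) (τ i a))) :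
    ∃ g : Matrix ι ι ℂ, (Matrix.of fun j i => (g.submatrix (F j) (F' i)).det).det ≠ 0 := by
  classical
  refine ⟨Matrix.of fun x y => if π x = y then (1 : ℂ) else 0, ?_⟩
  -- the pairing matrix is `σ.symm.permMatrix * diagonal ε`
  have hP : (Matrix.of fun j i =>
        ((Matrix.of fun x y : ι => if π x = y then (1 : ℂ) else 0).submatrix (F j) (F' i)).det) =
      Equiv.Perm.permMatrix ℂ (Equiv.symm σ) *
        Matrix.diagonal fun i => ((Equiv.Perm.sign (τ i) : ℤ) : ℂ) := by
    ext j i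
    rw [Matrix.mul_diagonal]
    simp only [of_apply, Equiv.Perm.permMatrix, PEquiv.toMatrix_apply, Equiv.toPEquiv_apply,
      Option.mem_def, Option.some.injEq]
    have hsub : (Matrix.of fun x y : ι => if π x = y then (1 : ℂ) else 0).submatrix (F j) (F' i) =
        Matrix.of fun a b : α => if F j a = F (σ i) (τ i b) then (1 : ℂ) else 0 := by
      ext a b
      simp only [submatrix_apply, of_apply, hF']
      by_cases h : F j a = F (σ i) (τ i b)
      · rw [if_pos h, if_pos (by rw [h])]
      · rw [if_neg h, if_neg (fun e => h (π.injective e))]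
    rw [hsub]
    by_cases hj : j = σ i
    · subst hj
      rw [coincidence_self _ (hF _), det_permutation, Equiv.Perm.sign_symm]
      have : (Equiv.symm σ) (σ i) = i := by simp
      rw [if_pos this, one_mul]
    · have hne : Finset.univ.image (F j) ≠ Finset.univ.image (F (σ i)) :=
        fun e => hj (hdist _ _ e)
      rw [det_coincidence_of_range_ne _ _ (hF _) hne]
      have : ¬ (Equiv.symm σ) j = i := by
        intro e; apply hj; rw [← e]; simp
      rw [if_neg this, zero_mul]
  rw [hP, det_mul, det_permutation, det_diagonal]
  refine mul_ne_zero ?_ ?_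
  · exact_mod_cast (Equiv.Perm.sign (Equiv.symm σ)).ne_zero
  · rw [Finset.prod_ne_zero_iff]
    intro i _
    exact_mod_cast (Equiv.Perm.sign (τ i)).ne_zero

/-! ## 4. The TT layout matrix as a pairing -/

/-- The layout matrix of item 19152 for `(u, w)` IS the pairing matrix of the row family
`i ↦ ρ_{u i}` and the column family `j ↦ τ_{w j}` (definitional unfolding, recorded for
certificate files): TT(u, w) is goodness of that pair. -/
theorem transversalMinor_layout_good_iff (h r : ℕ) (u w : Fin r → Finset (Fin h)) :
    (∃ H : Matrix (Fin (h + h)) (Fin (h + h)) ℂ,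
      (Matrix.of fun i j : Fin r => (H.submatrix
        (fun a : Fin h => if a ∈ u i then Fin.castAdd h a else Fin.natAdd h a)
        (fun c : Fin h => if c ∈ w j then Fin.natAdd h c else Fin.castAdd h c)).det).det ≠ 0) ↔
    (∃ g : Matrix (Fin (h + h)) (Fin (h + h)) ℂ,
      (Matrix.of fun i j : Fin r => (g.submatrix
        ((fun (i : Fin r) (a : Fin h) => if a ∈ u i then Fin.castAdd h a else Fin.natAdd h a) i)
        ((fun (j : Fin r) (c : Fin h) => if c ∈ w j then Fin.natAdd h c else Fin.castAdd h c)
          j)).det).det ≠ 0) :=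
  Iff.rfl

end Summit.ValiantsHypothesis.ValiantsHypothesis.Theorems.BarrierLever.Compression
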